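import Summits.Ventures.AbcSig.Levels.N5728P1
import Summits.Ventures.AbcSig.Levels.N5728P2

/-!
# Venture AbcSig — GENERATED level file, level 5728 (AGGREGATOR of 2 part files)

HONEST FRAMING. As in the part files `N5728<part>.lean`, parts P1, P2 (a MIXED split: parts of
different size-splits of the same generator output landed in the tree at different times; every part carries the orbit
blocks of one contiguous run of orbits of the same certified level file `N5728.engine1.json`,
sha256 `9df1d2785fc3264192eba5419e83d8d84d637cd076b5e3c4bfe0e2aa2ac3657a`): this file only concatenates the orbit lists and the part summaries into
`level5728Orbits`, `level5728_wellformed`, `level5728_sieve` (the shapes the row templates consume). The split exists because the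
tree's files are ≤ 400 lines and ≤ 200 000 bytes. Union of residual exponents ≥ 7: [7, 11, 13]; orbits not eliminable by
the sieve: none. No Diophantine statement is made here; no claim on ABC or any summit.
-/

namespace Summit.Ventures.AbcSig

/-- All newform orbits of level 5728 (concatenation of the parts, engine order). -/
def level5728Orbits : List OrbitData :=
  level5728OrbitsP1 ++ level5728OrbitsP2

/-- Every listed entry is at an odd prime not dividing 5728. -/
theorem level5728_wellformed :
    ∀ o ∈ level5728Orbits, ∀ e ∈ o.coeffs, e.ell.Prime ∧ e.ell ≠ 2 ∧ ¬ e.ell ∣ 5728 := by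
  unfold level5728Orbits
  exact List.forall_mem_append.2 ⟨level5728_wellformedP1, level5728_wellformedP2⟩

/-- **Level 5728 summary.** For a prime exponent `n ≥ 7`, every orbit of level 5728 is sieve-eliminated by the
kernel certificates of the part files, except that the row's predicate `X` is assumed for: orbit_5728_1 if n ∈ [7, 11], orbit_5728_2 if n ∈ [7, 11], orbit_5728_9 if n ∈ [13], orbit_5728_10 if n ∈ [13]. -/
theorem level5728_sieve (n : ℕ) (hn : n.Prime) (hmin : 7 ≤ n) (X : OrbitData → Prop)
    (h_orbit_5728_1 : n ∈ ([7, 11] : List ℕ) → X orbit_5728_1)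
    (h_orbit_5728_2 : n ∈ ([7, 11] : List ℕ) → X orbit_5728_2)
    (h_orbit_5728_9 : n ∈ ([13] : List ℕ) → X orbit_5728_9)
    (h_orbit_5728_10 : n ∈ ([13] : List ℕ) → X orbit_5728_10) :
    ∀ o ∈ level5728Orbits, (∀ e ∈ o.coeffs, e.ell.Prime ∧ e.ell ≠ 2 ∧ ¬ e.ell ∣ 5728) ∧ (o.Eliminated bs04Allowed n ∨ X o) := by
  unfold level5728Orbits
  exact List.forall_mem_append.2 ⟨(level5728_sieveP1 n hn hmin X h_orbit_5728_1 h_orbit_5728_2 h_orbit_5728_9 h_orbit_5728_10), (level5728_sieveP2 n hn hmin X)⟩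

end Summit.Ventures.AbcSig
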